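import Mathlib
import HarnessLib
import HarnessLib.Audit
import Summits.SmoothPoincare4.Statement
import Literature.Topology.FourManifolds.HomotopyS4CompactProofs
import Literature.Topology.FourManifolds.SphereSimplyConnected
import Literature.Geometry.Lorentzian.PseudoRiemannianMetric
import Literature.Geometry.Lorentzian.LeviCivita
import Literature.Geometry.Lorentzian.Volume
import Literature.Geometry.Lorentzian.EnergyCurrents
import Literature.Geometry.Riemannian.RiemannianDistance
import Literature.Geometry.Riemannian.IsotropicCurvature
import HarnessLib.Audit.Status.Attr

/-!
Route: IsotropicCorkBracketing

DORMANT since 2026-08-24T00:06:57Z (reconciler: no traction for 6.4 d (last activity item-evidence-added at 2026-08-17T14:50:48Z); parked, not closed — `ledger route dormant route-SmoothPoincare4-IsotropicCorkBracketing --off` to reacti) — unstaffed, not closed; items shared with open routes are served there. `ledger route dormant <id> --off` reactivates.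

# Route IsotropicCorkBracketing — Chen–Zhu's isotropic Yamabe form brackets across a cork — SPC4 as
Neumann positivity of −6Δ+R−6λ_W on the two honest pieces of S⁴

It suffices to show X = ISOTROPIC FORM POSITIVITY: every closed smooth 4-manifold M ≃ₕ S⁴ carries a
Riemannian metric G whose
Chen–Zhu isotropic Yamabe form Q_G(u) = ∫_M (6|∇u|²_G + 3 m_G u²) dV_G is positive definite on C¹(M)
(c∫u² ≤ Q_G(u), c > 0), where
3 m_G = R_G − 6 max(λ_max W⁺, λ_max W⁻) is three times the minimal isotropic curvature (typed with
any continuous lower bound μ ≤ the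
tree's `isotropicCurvature` over orthonormal 4-frames). X ⇔ GY(M) > 0 (ChenZhu2014 §2–3) ⇔ M carries
a PIC metric (first-eigenfunction
conformal change, ChenZhu2014 Cor. 2.2) ⇒ M ≅ S⁴ (Hamilton 1997 Cor. 1.2(a) / Chen–Tang–Zhu 2012,
tree fact `hamilton_pic_sphere_four`), and
SPC4 ⇒ X (round metric, m ≡ 4): no slack is lost. The LINE OF ATTACK is the Rayleigh-bracketing
mechanism of card psc-cork-fillin (§2),
moved from the conformal Laplacian to Chen–Zhu's modified one so that it decides the Statement (the
gen-1 route PscCorkFillIn, retired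
not-a-thesis, stopped at PSC-ALL): present M as a cork twist C ∪_(φτ) W of S⁴ = C ∪_φ W and certify
Q piecewise — NEUMANN positivity of
the form on each honest piece (crux CorkIsotropicBracketing) adds up across the seam (support
NeumannBracketing), the cork side being
asked to absorb the twist against the ROUND exterior (crux CorkSideIsotropicFillIn).
Lean: `∀ (M : Type) [TopologicalSpace M] [T2Space M] [SecondCountableTopology M] [ChartedSpace
(EuclideanSpace ℝ (Fin 4)) M] [IsManifold (𝓡 4) ∞ M] [CompactSpace M] [MeasurableSpace M]
[BorelSpace M], M ≃ₕ Metric.sphere (0 : EuclideanSpace ℝ (Fin 5)) 1 → ∃ G :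
Literature.Geometry.Lorentzian.PseudoRiemannianMetric (𝓡 4) ∞ (EuclideanSpace ℝ (Fin 4))
(TangentSpace (𝓡 4) : M → Type _), ∃ hG : G.IsRiemannian, ∃ _ : G.HasLeviCivita, (∃ c : ℝ, 0 < c ∧ ∃
μ : M → ℝ, Continuous μ ∧ (∀ (x : M) (e : Fin 4 → TangentSpace (𝓡 4) x), G.IsOrthonormalFrame x e →
μ x ≤ G.isotropicCurvature G.leviCivita x e) ∧ ∀ u : M → ℝ, ContMDiff (𝓡 4) 𝓘(ℝ, ℝ) 1 u → c * ∫ x, u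
x ^ 2 ∂(Literature.Geometry.Lorentzian.riemannianMeasure (G.toContMDiffRiemannianMetric hG)) ≤ ∫ x,
(6 * G.gradSq u x + 3 * μ x * u x ^ 2) ∂(Literature.Geometry.Lorentzian.riemannianMeasure
(G.toContMDiffRiemannianMetric hG)))`

## Assembly
Pure logic plus two PROVED discharges of the tree: given M ≃ₕ S⁴ (the summit's binders), M is
compact
(`compactSpace_of_homotopyEquiv_sphere_four_holds`) and simply connected
(`simplyConnectedSpace_sphere_four_holds` transported along the
homotopy equivalence), its Borel σ-algebra is chosen, IsotropicFormPositive supplies G, ConformalPic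
a PIC metric, HamiltonChenTangZhu the
diffeomorphism: `theorem closes (hT : IsotropicFormPositive) (hC : ConformalPic) (hH :
HamiltonChenTangZhu) : SmoothPoincare4`, PROVED
sorry-free in the planner's Sketch.lean (axioms propext / Classical.choice / Quot.sound) and filed
as glue.lean. Layer 2 (CorkReduction,
RoundSideGivesBracketing) feeds the target from the cork cruxes.

Rationale: WHY THIS LINE. In dimension 4 the modified scalar curvature σ_g = R − 6 max(λ_max W⁺, λ_max W⁻) has
conformal weight −2, its conformal Laplacian
−6Δ + σ_g is conformally covariant, and σ_g > 0 is EXACTLY positive isotropic curvature (ChenZhu2014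
= arXiv:1206.5051, (2.8), Cor. 2.2,
§3; Gursky2000/GurskyLebrun1999 for the modified-scalar-curvature idea; MicallefWang1993,
Hamilton1997 for the block criterion), so SPC4
becomes the SIGN of the bottom of the spectrum of a Schrödinger operator on Σ (GY(Σ) > 0,
ChenZhu2014 Thm 1.7 + π₁ = 1) — weaker than the
8π² Weyl budget of route WeylBudget (ChangGurskyYang2003 ⇒ GY > 0, ChenZhu2014 Remark 1.5) and,
unlike an L² budget or the pointwise PIC
ask of route PIC, a QUADRATIC-FORM condition, which localises exactly under cut-and-paste:
Dirichlet–Neumann bracketing (Reed–Simon IV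
§XIII.15; Cycon–Froese–Kirsch–Simon, lit panama:375646429642774) gives λ₁(Σ) ≥ min of the Neumann
ground states of the pieces, with no
matching condition and no energy bookkeeping across the seam. By the cork theorem
(CurtisFreedmanHsiangStong1996, Matveyev1996, Θ₄ = 0
KervaireMilnorAnnals1963; tree `HomotopySphere.exists_corkPresentation_of_facts`) the pieces are
honest compact submanifolds of the ROUND
S⁴ (m ≡ 4, Neumann-positive with margin 12), and all the difficulty sits in one compact contractible
C carrying the τ-twisted round germ.
Imported: spectral theory of Schrödinger operators (bracketing, ground states), conformal geometry
(Chen–Zhu/Gursky modified Yamabe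
problem), Ricci flow with surgery as a named recognition fact, cork theory; no probabilistic or
arithmetic reformulation. What prior
routes do not do: PIC/WeylBudget/BachCriticalElement work on the unknown Σ or need one globally
small energy; PscCorkFillIn localised but
only for scal > 0 (⇏ SPC4); the negatives index is empty.

RANKED CRUXES. #0 IsotropicFormPositive (target) — X as in § Thesis: every closed smooth M ≃ₕ S⁴
carries a Riemannian metric with positive definite isotropic Yamabe form (⇔ GY(M) > 0 ⇔ a PIC metric
exists ⇔ SPC4, given the facts). (why it might fail: Equivalent to SPC4 mod ChenZhu2014 Cor 2.2 +
hamilton_pic_sphere_four: an exotic Σ has GY(Σ) ≤ 0 in every conformal class; as a programme nothing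
but transport from S⁴ bounds the form on an unidentified Σ.) [ChenZhu2014, arXiv:1206.5051,
Hamilton1997, ChenTangZhu2012, MicallefWang1993]
#2 HamiltonChenTangZhu (crux) — FIRST CRUX = the unproved NAMED FACT the deciding theorem rests on
(plancard rule: routes conditional on an unproved cone fact list it first): a closed simply
connected smooth 4-manifold with a Riemannian metric of positive isotropic curvature is
diffeomorphic to S⁴ — verbatim `Literature.Geometry.Riemannian.hamilton_pic_sphere_four` (Hamilton
1997 Cor. 1.2(a); surgery completed by Chen–Zhu 2006, Chen–Tang–Zhu 2012), the same fact route PIC's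
Assembly2 takes inline. Expected to be settled by vendoring/`_holds`, not by a route prover.
[difficulty: open-problem] (why it might fail: Published theorem (Ricci flow with surgery under
PIC); the only risks are vendoring fidelity — the tree's HasPositiveIsotropicCurvature quantifies
over Levi-Civita connections of a C^∞ metric — and that a Lean proof is far out of reach.)
[Hamilton1997, ChenZhu2006, ChenTangZhu2012,
Literature.Geometry.Riemannian.hamilton_pic_sphere_four]
#3 CorkIsotropicBracketing (crux) — THE MECHANISM (card psc-cork-fillin §2, bracketing variant, one
curvature level up): for every splitting of the standard sphere S⁴ = C ∪_φ W into a compact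
contractible piece C and a compact piece W (a boundary gluing, typed with the boundary 3-manifolds
Z_C, Z_W, their embeddings ι_C, ι_W onto (𝓡∂ 4).boundary and the piece embeddings explicit — no
`BoundaryData`/`IsBoundaryGluing` vocabulary since the cone repair of 2026-08-15) and every
self-diffeomorphism τ of ∂C = Z_C, every smooth closed P presented as the twisted gluing C ∪_(φ∘τ) W
(explicit piece embeddings jC, jW covering P and meeting exactly along ∂C ≡ ∂W) carries a Riemannian
metric G such that EACH PIECE is Neumann-isotropic-positive: for a continuous lower bound μ of the
isotropic curvatures of G and some c > 0, c∫_piece u² ≤ ∫_piece (6|∇u|² + 3μu²) for all u ∈ C¹(P).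
With NeumannBracketing + SeamNull this gives X for P; with CorkPresentation, for every homotopy
4-sphere (glue CorkReduction). SPC4 ⇒ it (RoundPullback: pulled-back round metric, μ ≡ 4, c = 12),
so it is SPC4 restricted to cork twists, stated on honest pieces. [difficulty: open-problem] (why it
might fail: False for any exotic cork twist (⇔ SPC4 on cork twists mod the facts); as a programme
the twist region near ∂C must carry negative isotropic curvature whenever τ is not a collar
isometry, and no estimate bounds its spectral cost from above.) [ChenZhu2014, Matveyev1996,
CurtisFreedmanHsiangStong1996, AkbulutMatveyev1998, BarHanke2023,
Literature.Barriers.SmoothPoincare4.RelativeContractibleBarrierFour]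
#4 CorkSideIsotropicFillIn (crux) — THE CORK ABSORBS THE TWIST AGAINST THE ROUND EXTERIOR
(one-sided, recommended first attack and calibration): with the data of CorkIsotropicBracketing and
the S⁴-side embeddings kC, kW explicit, P carries a Riemannian G which on the exterior piece is
ROUND — G = f*⟨·,·⟩_ℝ⁵ on T_pP for p ∈ jW(W), for a smooth f : P → S⁴ with f ∘ jW = kW — and is
Neumann-isotropic-positive on the cork piece jC(C). Equivalently: the compact contractible C admits
a metric whose boundary germ is the τ-TWISTED round germ of ∂C ⊂ S⁴ and whose Neumann ground state
of −6Δ + 3m is positive. NOT implied by SPC4 (even for cork twists known to be standard the round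
exterior sits exotically re-embedded, cf. card cork-twins-census), so it is a genuine test of the
mechanism on e.g. the Akbulut–Mazur cork, where P ≅ S⁴ is known; true when τ extends over C (pull
back). [deps: CorkIsotropicBracketing] [difficulty: open-problem] (why it might fail: Strictly
stronger than SPC4: freezing the exterior round may be impossible even when P ≅ S⁴ (metric rigidity
of exotically re-embedded cork exteriors); and the twisted collar forces a region of negative
isotropic curvature whose Neumann cost on a thin cork may exceed the interior margin 12·vol.)
[ChenZhu2014, AkbulutMatveyev1998, Akbulut1991Fake, AkbulutRuberman2016, BarHanke2021,
Literature.Barriers.SmoothPoincare4.RelativeContractibleBarrierFour]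
#9 ConformalPic (support) — Chen–Zhu's first step (KNOWN; ChenZhu2014 Cor. 2.2 = GurskyLebrun1999
Prop. 3, and §3 first paragraph): on a closed smooth 4-manifold, a Riemannian metric with positive
definite isotropic Yamabe form is conformal to — in particular there exists — a metric of positive
isotropic curvature (first eigenfunction u > 0 of −6Δ + 3μ_ε for a smoothing μ_ε ≤ μ; σ_(u²g) =
u⁻³(−6Δu + σ_g u) > 0; σ > 0 ⇔ PIC by the Hamilton/Micallef–Wang block criterion). [difficulty: XL]
[ChenZhu2014, GurskyLebrun1999, Gursky2000, MicallefWang1993, Hamilton1997,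
Literature.Geometry.Riemannian.hamilton_positiveIsotropicCurvature_iff_blocks]
#9 NeumannBracketing (support) — DIRICHLET–NEUMANN BRACKETING, the half that is pure measure theory:
if closed sets S₁, S₂ cover P with dV_G(S₁ ∩ S₂) = 0 and the isotropic form of G is Neumann-positive
on each (constants c₁, c₂; lower bounds μ₁, μ₂ ≤ isotropic curvatures), then it is positive on P
with c = min(c₁,c₂) and μ = max(μ₁,μ₂) (∫_P = ∫_S₁ + ∫_S₂; integrability of 6|∇u|² + 3μu² for u ∈ C¹
on compact P). [difficulty: M] [panama:375646429642774, Chavel2006, Federer1969]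
#9 SeamNull (support) — the seam of a boundary gluing is a null set: for compact pieces C, W
embedded in a closed 4-manifold P as a gluing along ψ (explicit embeddings), the common image jC(C)
∩ jW(W) = jC(∂C) — a compact smooth hypersurface — has Riemannian measure zero for every Riemannian
metric on P (chart formula for dV + Lebesgue-nullity of C¹ images of 3-manifolds). [difficulty: L]
[Federer1969, Chavel2006, Hirsch1976]
#9 CorkPresentation (support) — NAMED-FACT ITEM (Θ₄ = 0 + the cork theorem in Matveyev's two-piece
form; PROVED in the tree from those two facts as
`Literature.Topology.FourManifolds.HomotopySphere.exists_corkPresentation_of_facts`, here in the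
summit's binder form): every smooth closed M ≃ₕ S⁴ is C ∪_(φ∘τ) W where S⁴ = C ∪_φ W, C compact
contractible, W compact, both smooth 4-manifolds with boundary, τ ∈ Diff(∂C); boundary data and both
gluings are unbundled into explicit binders (the fields of `BoundaryData`, the definiens of
`IsBoundaryGluing`), so a prover rebundles them and applies the tree lemma in a Theorems file.
Packaging M ≃ₕ S⁴ as a HomotopySphere uses the proved compactness/orientability discharges.
[difficulty: open-problem] [Matveyev1996, CurtisFreedmanHsiangStong1996, KervaireMilnorAnnals1963,
Literature.Topology.FourManifolds.isHCobordant_sphere_of_homotopySphere_four,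
Literature.Topology.FourManifolds.Matveyev1996_decomposition]
#9 RoundPullback (support) — NO SLACK LOST / KILL-DIRECTION ENGINE: a closed 4-manifold
diffeomorphic to S⁴ carries a Riemannian metric (the pulled-back round one, isotropic curvature ≡ 4)
whose isotropic form is Neumann-positive on EVERY measurable subset, with μ ≡ 4 and c = 12. Hence a
cork twist P for which CorkIsotropicBracketing fails is exotic (¬SPC4), and SPC4 ⇒
CorkIsotropicBracketing. [difficulty: L] [ONeill1983, MicallefMoore1988,
Literature.Geometry.Riemannian.roundMetric]
#9 CorkReduction (support) — LAYER-2 GLUE (pure logic: the M-side gluing delivered by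
CorkPresentation is literally the hypothesis list of SeamNull / CorkIsotropicBracketing; ranges of
the compact pieces are closed): CorkPresentation → SeamNull → NeumannBracketing →
CorkIsotropicBracketing → IsotropicFormPositive. [difficulty: provable-now] [BrockerJanich1982,
Hirsch1976]
#9 RoundSideGivesBracketing (support) — GLUE for the one-sided crux: a metric that is round on the
exterior piece (local isometry f into S⁴ ⊂ ℝ⁵) has isotropic curvature ≡ 4 there (naturality of
curvature under local isometries, continuity of the minimal isotropic curvature up to the seam), so
the exterior piece is Neumann-positive with μ = minimal isotropic curvature of G and c = 12; hence
CorkSideIsotropicFillIn → CorkIsotropicBracketing. [difficulty: L] [ONeill1983, MicallefMoore1988,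
Literature.Geometry.Lorentzian.PseudoRiemannianMetric.comap]

TWO-LAYER PLAN. Foreseen glued splits (none filed now; k ≤ 3, depth 1). CorkSideIsotropicFillIn ⇐
(TwistedCollarInterpolation: on ∂C × [0,1] a metric
interpolating the τ-twisted round germ at 0 to SOME germ γ at 1, with Neumann-isotropic cost −κ) →
(InteriorMargin: a metric on C with
boundary germ γ and Neumann ground state > κ·(overlap constant) — round-like interiors give 12) →
CorkSideIsotropicFillIn.
CorkIsotropicBracketing ⇐ (SymmetricGerm: a Neumann-isotropic-positive metric on S⁴ whose germ along
∂C is τ-invariant — the shared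
special case with WeylBudget's CorkRegluablePsc, isotropic version) → (IsometricRegluingTransfers:
collar-isometric regluing transports
both piece forms verbatim) → CorkIsotropicBracketing. IsotropicFormPositive for Gluck twists is, by
ConformalPic, route PIC's
PicGluckV2 (not re-filed).

KILL CRITERIA. - CorkIsotropicBracketing REFUTED for an explicit (C, W, φ, τ): by RoundPullback that
P is an exotic 4-sphere — SPC4 is refuted and the
  route closes with the problem (`close --reason refuted:CorkIsotropicBracketing`, file
¬SmoothPoincare4 with the tenure planner).
- CorkSideIsotropicFillIn refuted (round exterior cannot be matched): NOT a kill — drop/restate crux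
4 to a two-sided form (both pieces
  move); the refutation is itself a rigidity theorem about exotic re-embeddings worth a Theorems
file.
- ConformalPic or NeumannBracketing shown false AS TYPED (regularity/junk-value artefact of the C¹
test class or of `gradSq`): restate
  with the corrected functional class; the mathematics (ChenZhu2014 Cor 2.2; bracketing) is not in
doubt.
- IsotropicFormPositive proved elsewhere (route PIC's PicThesisV2, or WeylBudget's WeylLight via
ChenZhu2014 Remark 1.5): superseded.

NOT DECOMPOSED YET. - The twisted-collar cost κ(∂C ⊂ S⁴, τ) and the interior margin as separate
items (layer 2 of crux 4) — only after crux 4 is attacked on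
  one concrete cork (Akbulut–Mazur in D(C) = S⁴, AkbulutMatveyev1998).
- The symmetric-germ special case (shared with WeylBudget) and Gluck twists (shared with PIC) —
other routes' items, linked not re-filed.
- Robin (conformally invariant, Escobar-type) piece forms ∫(6|∇u|² + 3m u²) + 2∮H u², which bracket
equally well because the outward
  mean curvatures cancel across the seam and would make each piece's condition a conformal invariant
of (piece, [g]) — not needed for X.
- A packaged definition `NeumannIsotropicFormPos` / `minIsotropicCurvature` (definition request
below) — items inline the form for now.
- The negative programme (card §5): lower bounds for the Neumann cost of a twisted collar via
band-width / μ-bubble inequalities, which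
  apply since PIC ⇒ scal > 0 — typed only against a concrete cork.

CHEAPEST FALSIFIER. Lookup done this session: ChenZhu2014 (arXiv:1206.5051 READ, pp. 1–10) confirms
every analytic identity used ((2.8) with n = 4:
coefficient 6 and weight −2; Cor. 2.2; §3: σ_g > 0 ⇔ PIC; GY(CP²) = GY(T⁴) = 0, GY(S³×S¹) = Y(S⁴)),
so the reformulation X ⇔ SPC4 is
safe. Cheapest check that would kill the MECHANISM (not the truth of X): take C = B⁴ ⊂ S⁴ (a
hemisphere) and τ ∈ Diff(S³) far from
O(4) but isotopic to an isometry (all are, Cerf/Hatcher): minimise numerically (finite elements on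
B⁴, kit) the Neumann ground state of
−6Δ + 3m over metrics with the τ-twisted round germ; if even here positivity needs the interpolation
to retreat deep into the ball
(cost growing with the C²-size of τ without bound), crux 4 is hopeless for thin corks and the route
must pivot to the two-sided/symmetric
germ forms. Not run here (no mesh/kit job prepared in a plancard seat).

NUMBERS. - Conformal law (n = 4): σ_(u²g) = u⁻³(−6Δ_g u + σ_g u), σ_g = R_g − 6 max(λ_max W⁺, λ_max
W⁻) = 3 × (minimal isotropic curvature in the
  tree's normalisation: unit S⁴ has isotropicCurvature ≡ 4, R = 12, W = 0). ChenZhu2014 (2.8), §3.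
- GY(S⁴) = Y(S⁴) = 8√6·π ≈ 61.56 (vol-normalised); GY(CP²) = GY(T⁴) = 0; GY(S³×S¹) = Y(S⁴)
(ChenZhu2014 §3 i–iii).
- Round pieces: μ ≡ 4, Neumann constant c = 12 (= R); CGY budget ∫|W|² < 4π²χ implies GY > 0
(ChenZhu2014 Thm 1.4 / Remark 1.5).
- Items at open: 12 (1 target, 3 cruxes incl. the named fact, 7 support, 1 assembly).
- Cone repair 2026-08-15 (rev 1): route imports 9 → 8 — `Literature.Topology.FourManifolds.Gluing`
dropped together with its
  Cobordism/Isotopy cone, which carried 5 unproved named facts no item uses (incl. Freedman's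
`nonempty_homeomorph_of_isHCobordant_four`);
  the four cork items were restated 1:1 (provably equivalent, planner's SanityBridge.lean) over
Mathlib-only binders. Every remaining
  route-specific cone fact is proved; the unproved facts of `SPC4Wave0` enter through the operator's
Statement.lean (shared by all routes).

DEFINITION REQUESTS. - `NeumannIsotropicFormPos (G) (S : Set P) : Prop` and `minIsotropicCurvature G
x : ℝ` (inf over orthonormal 4-frames of
  `isotropicCurvature`, with its continuity lemma), topic Literature/Geometry/Riemannian — to
replace the inlined
  `∃ c > 0, ∃ μ, Continuous μ ∧ (∀ x e, IsOrthonormalFrame → μ x ≤ isotropicCurvature …) ∧ ∀ u ∈ C¹,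
c∫u² ≤ ∫(6 gradSq u + 3μu²)` clause.
- Cite fact wanted: ChenZhu2014 Cor. 2.2 + §3 (positive isotropic Yamabe form ⇒ a conformal PIC
metric) as a Literature named fact
  `chenZhu_pic_of_isotropicFormPos`, verbatim the statement of item ConformalPic.

Novelty: Searches (2026-08-15): `lit search` ×3 ("positive isotropic curvature conformal class four-manifold
Weyl eigenvalue criterion", "Chen Zhu
conformally invariant classification …", "generalized Yamabe invariant isotropic curvature …") —
searchd rc 75 all session (off-box
service down), recorded; `lit read doi:10.4310/cag.2014.v22.n5.a2` → held paper arxiv-1206.5051 READ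
pp. 1–10; `lit galaxy search --star
all`: "generalized Yamabe invariant" (0), "conformally invariant classification theorem in four"
(0), "modified scalar curvature" (2:
Chow et al. Ricci flow book; an unrelated CR paper), "Neumann bracketing" (12: spectral-theory texts
— Cycon–Froese–Kirsch–Simon
panama:375646429642774, Lewin; none geometric-topological), "cork twist" (0 relevant); tree/ledger:
grep of all 33 Theses files and 34
Ideas files of the sub for ChenZhu2014 / generalized or modified Yamabe / λ_max — only WeylBudget
cites ChenZhu2014 (as an alternative
recognition theorem; its target is the CGY L² budget), no route or card uses GY, σ_g or bracketing;
`ledger negatives` = 0; the 136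
cards of the sub (ledger idea list) — nearest: psc-cork-fillin (this card: bracketing for −6Δ+R,
reaches PSC only),
weyl-budget-cork-regluing (isometric regluing + L² Weyl budget), yamabe-extremal-or-thin (ordinary
Yamabe invariant, no localisation),
curvature-certificates-numerical-ricci-flow (CGY certificates).
Nearest prior art found: ChenZhu2014 (arXiv:1206.5051) Thm 1.7 + Cor 2.2 — GY(M⁴) > 0 ⇒ S⁴ # mRP⁴ #
(S³×ℝ)/Γᵢ, vi  [refs: 10.4310/cag.2014.v22.n5.a2`, 1206.5051, doi:10.4310/cag.2014.v22.n5.a2, arxiv-1206.5051, ChenZhu2014]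

Barriers (technique_class: isotropic-yamabe-bracketing; cork-regluing; conformal-PIC): - technique_class: isotropic-yamabe-bracketing; cork-regluing; conformal-PIC
- Literature.Barriers.SmoothPoincare4.HCobordismBarrierFour: evaded as in route PIC — no
h-cobordism/handle argument produces the diffeomorphism; it comes from Ricci flow with surgery under
PIC (named fact HamiltonChenTangZhu); the h-cobordism enters only through the cork presentation of
Σ, as input.
- Literature.Barriers.SmoothPoincare4.RelativeContractibleBarrierFour: corks exist and τ never
extends over C — this is the INPUT (CorkPresentation); no item asks to extend τ; crux 4 asks for a
metric on C with a twisted germ, a different object, and its failure mode (metric rigidity of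
re-embedded exteriors) is recorded as informative, not assumed away.
- Literature.Barriers.SmoothPoincare4.GaugeSumBarrierFour: GY > 0 / PIC-conformality is used as an
existence TARGET equivalent to SPC4, never as a detecting invariant to be compared across connected
sums or stabilisations; nothing to evade.
- Literature.Barriers.SmoothPoincare4.StableBarrierFour: same — no stabilisation by S²×S² occurs
(indeed GY(Σ # S²×S²)-type questions are irrelevant to the items).
- Literature.Barriers.SmoothPoincare4.TopologicalBarrierFour: the form Q_G depends on the smooth
metric, not on the homeomorphism type; the route needs it only on the given smooth structure.
- Literature.Barriers.SmoothPoincare4.HCobordismInvariantBarrierFour: not engaged — no h-cobordism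
invariant is computed.
- Literature.Barriers.SmoothPoincare4.CircleAc

Novelty grade: new-combination — ROUTE REVIEW (refuter rreview-0815T14-7, 2026-08-15; file REVIEW-IsotropicCorkBracketing.md on stmt-SmoothPoincare4-9834). Grade new-combination: Chen–Zhu's conformally covariant modified Laplacian −6Δ+σ_g (σ>0 ⇔ PIC) + cork presentation of homotopy 4-spheres + Dirichlet–Neumann bracketing; nothing  (refuter refuter-rreview-0815T14-7-0, 2026-08-15T15:12:23Z; prior: ChenZhu2014 arXiv:1206.5051 Thm 1.7 / Cor 2.2 / (2.8) (isotropic Yamabe invariant GY, σ_g = R − 6 max λ_max W±), GurskyLebrun1999 Prop 3 / Gursky2000 (modified scalar curvature), Hamilton1997 + ChenTangZhu2012 (PIC ⇒ S⁴ for π₁ = 1; crux 9824 = known theorem), Matveyev1996 / CurtisFreedmanHsiangStong1996 / KervaireMilnor1963 (cork presentation; in tree), Reed–Simon IV §XIII.15 / Cycon–Froese–Kirsch)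

History (route lifecycle, newest last):
- 2026-08-15T16:53:31Z · rev 1: restated CorkIsotropicBracketing (stmt-SmoothPoincare4-9825), CorkSideIsotropicFillIn (stmt-SmoothPoincare4-9826), SeamNull (stmt-SmoothPoincare4-9829), CorkPresentation (stmt-SmoothPoincare4-9830) — cone repair (route-repair seat b3a947e6): drop import Literature.Topology.FourManifolds.Gluing (+Cobordism/Isotop (planner-rrepair-SmoothPoincare4-IsotropicCorkB-b3a947e6-g2-0)
- 2026-08-16T04:18:38Z · AUTO-CRUX (backfill): IsotropicFormPositive — hypotheses of the deciding theorem that nothing in the route derives are cruxes (operator:999:1085951)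
- 2026-08-24T00:06:57Z · DORMANT — reconciler: no traction for 6.4 d (last activity item-evidence-added at 2026-08-17T14:50:48Z); parked, not closed — `ledger route dormant route-SmoothPoincare4- (operator:999:730932)

sub-problem: SmoothPoincare4 · status: dormant · opened planner-plancard-SmoothPoincare4-SmoothPoinca-8497055e-g2-0 2026-08-15T14:31:20Z · rev 2 · ledger route-SmoothPoincare4-IsotropicCorkBracketing
GENERATED by the gate from the ledger (D-0016/17). Provers cite these decls: `theorem foo : Summit.SmoothPoincare4.SmoothPoincare4.Theses.IsotropicCorkBracketing.<Decl> := …` in Summits/SmoothPoincare4/SmoothPoincare4/Theorems/<Name>.lean.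
-/

namespace Summit.SmoothPoincare4.SmoothPoincare4.Theses.IsotropicCorkBracketing

open scoped BigOperators Topology Manifold Classical MeasureTheory ProbabilityTheory Matrix InnerProductSpace ComplexConjugate ContinuousMap ContDiff
open Filter Set Function TopologicalSpace MeasureTheory

attribute [summit_statement] _root_.SmoothPoincare4

open Literature.SPC4

/-- item stmt-SmoothPoincare4-9823 · crux (kind.auto-crux: conjecture-grade) · rank 0 · open · by planner
why it might fail: Equivalent to SPC4 mod ChenZhu2014 Cor 2.2 + hamilton_pic_sphere_four: an exotic Σ has GY(Σ) ≤ 0 in every conformal class; as a programme nothing but transport from S⁴ bounds the form on an unidentified Σ.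
sources: ChenZhu2014, arXiv:1206.5051, Hamilton1997, ChenTangZhu2012, MicallefWang1993
[target] X as in § Thesis: every closed smooth M ≃ₕ S⁴ carries a Riemannian metric with positive
definite isotropic Yamabe form (⇔ GY(M) > 0 ⇔ a PIC metric exists ⇔ SPC4, given the facts). -/
@[route_item "route-SmoothPoincare4-IsotropicCorkBracketing", crux]
def IsotropicFormPositive : Prop :=
  ∀ (M : Type) [TopologicalSpace M] [T2Space M] [SecondCountableTopology M] [ChartedSpace (EuclideanSpace ℝ (Fin 4)) M] [IsManifold (𝓡 4) ∞ M] [CompactSpace M] [MeasurableSpace M] [BorelSpace M], M ≃ₕ Metric.sphere (0 : EuclideanSpace ℝ (Fin 5)) 1 → ∃ G : Literature.Geometry.Lorentzian.PseudoRiemannianMetric (𝓡 4) ∞ (EuclideanSpace ℝ (Fin 4)) (TangentSpace (𝓡 4) : M → Type _), ∃ hG : G.IsRiemannian, ∃ _ : G.HasLeviCivita, (∃ c : ℝ, 0 < c ∧ ∃ μ : M → ℝ, Continuous μ ∧ (∀ (x : M) (e : Fin 4 → TangentSpace (𝓡 4) x), G.IsOrthonormalFrame x e → μ x ≤ G.isotropicCurvature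 G.leviCivita x e) ∧ ∀ u : M → ℝ, ContMDiff (𝓡 4) 𝓘(ℝ, ℝ) 1 u → c * ∫ x, u x ^ 2 ∂(Literature.Geometry.Lorentzian.riemannianMeasure (G.toContMDiffRiemannianMetric hG)) ≤ ∫ x, (6 * G.gradSq u x + 3 * μ x * u x ^ 2) ∂(Literature.Geometry.Lorentzian.riemannianMeasure (G.toContMDiffRiemannianMetric hG)))

/-- item stmt-SmoothPoincare4-9824 · crux · rank 2 · open · by planner
why it might fail: Published theorem (Ricci flow with surgery under PIC); the only risks are vendoring fidelity — the tree's HasPositiveIsotropicCurvature quantifies over Levi-Civita connections of a C^∞ metric — and that a Lean proof is far out of reach.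
sources: Hamilton1997, ChenZhu2006, ChenTangZhu2012, Literature.Geometry.Riemannian.hamilton_pic_sphere_four
[crux] FIRST CRUX = the unproved NAMED FACT the deciding theorem rests on (plancard rule: routes
conditional on an unproved cone fact list it first): a closed simply connected smooth 4-manifold
with a Riemannian metric of positive isotropic curvature is diffeomorphic to S⁴ — verbatim
`Literature.Geometry.Riemannian.hamilton_pic_sphere_four` (Hamilton 1997 Cor. 1.2(a); surgery
completed by Chen–Zhu 2006, Chen–Tang–Zhu 2012), the same fact route PIC's Assembly2 takes inline.
Expected to be settled by vendoring/`_holds`, not by a route prover. [difficulty: open-problem] -/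
@[route_item "route-SmoothPoincare4-IsotropicCorkBracketing", crux]
def HamiltonChenTangZhu : Prop :=
  ∀ (M : Type) [TopologicalSpace M] [T2Space M] [SecondCountableTopology M] [ChartedSpace (EuclideanSpace ℝ (Fin 4)) M] [IsManifold (𝓡 4) ∞ M] [CompactSpace M] [SimplyConnectedSpace M], (∃ g : Literature.Geometry.Lorentzian.PseudoRiemannianMetric (𝓡 4) ∞ (EuclideanSpace ℝ (Fin 4)) (TangentSpace (𝓡 4) : M → Type _), g.IsRiemannian ∧ g.HasPositiveIsotropicCurvature) → Nonempty (M ≃ₘ⟮𝓡 4, 𝓡 4⟯ Metric.sphere (0 : EuclideanSpace ℝ (Fin 5)) 1)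

-- earlier CorkIsotropicBracketing (stmt-SmoothPoincare4-9825, replaced 2026-08-15T16:53:31Z -> stmt-SmoothPoincare4-11210): retired by None — ∀ (C : Type) [TopologicalSpace C] [T2Space C] [SecondCountableTopology C] [ChartedSpace (EuclideanHalfSpace 4) C] [IsManifold (𝓡∂ 4) ∞ C] [CompactSpace C] [ContractibleSpace C] (bC : Literature.Topology.FourManifolds.BoundaryData (𝓡∂ 4) C (𝓡 3)) (W : Type) [To
/-- item stmt-SmoothPoincare4-11210 · crux · rank 3 · open · by planner
why it might fail: False for any exotic cork twist (⇔ SPC4 on cork twists mod the facts); as a programme the twist region near ∂C must carry negative isotropic curvature whenever τ is not a collar isometry, and no estimate bounds its spectral cost from above.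
sources: ChenZhu2014, Matveyev1996, CurtisFreedmanHsiangStong1996, AkbulutMatveyev1998, BarHanke2023, Literature.Barriers.SmoothPoincare4.RelativeContractibleBarrierFour
[crux] THE MECHANISM (card psc-cork-fillin §2, bracketing variant, one curvature level up): for
every splitting of the standard sphere S⁴ = C ∪_φ W into a compact contractible piece C and a
compact piece W — typed WITHOUT the tree's `BoundaryData`/`IsBoundaryGluing` vocabulary (cone repair
2026-08-15, meaning unchanged): ∂C, ∂W enter as smooth 3-manifolds Z_C, Z_W with smooth embeddings
ι_C, ι_W onto (𝓡∂ 4).boundary C resp. W, and the splitting of S⁴ as explicit piece embeddings kC, kW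
covering S⁴ and meeting exactly along ι_C z ↔ ι_W (φ z) — and every self-diffeomorphism τ of Z_C,
every smooth closed P presented as the twisted gluing C ∪_(φ∘τ) W (explicit piece embeddings jC, jW
covering P and meeting exactly along ∂C ≡ ∂W) carries a Riemannian metric G such that EACH PIECE is
Neumann-isotropic-positive: for a continuous lower bound μ of the isotropic curvatures of G and some
c > 0, c∫_piece u² ≤ ∫_piece (6|∇u|² + 3μu²) for all u ∈ C¹(P). With NeumannBracketing + SeamNull
this gives X for P; with CorkPresentation, for every homotopy 4-sphere (glue CorkReduction). SPC4 ⇒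
it (RoundPullback: pulled-back round metric, μ ≡ 4, c = 12), so it is SPC4 restricted to cork
twists, stated on -/
@[route_item "route-SmoothPoincare4-IsotropicCorkBracketing", crux]
def CorkIsotropicBracketing : Prop :=
  ∀ (C : Type) [TopologicalSpace C] [T2Space C] [SecondCountableTopology C] [ChartedSpace (EuclideanHalfSpace 4) C] [IsManifold (𝓡∂ 4) ∞ C] [CompactSpace C] [ContractibleSpace C] (ZC : Type) [TopologicalSpace ZC] [ChartedSpace (EuclideanSpace ℝ (Fin 3)) ZC] [IsManifold (𝓡 3) ∞ ZC] (ιC : ZC → C) (_ : Manifold.IsSmoothEmbedding (𝓡 3) (𝓡∂ 4) ∞ ιC) (_ : Set.range ιC = (𝓡∂ 4).boundary C) (W : Type) [TopologicalSpace W] [T2Space W] [SecondCountableTopology W] [ChartedSpace (EuclideanHalfSpace 4) W] [IsManifold (𝓡∂ 4) ∞ W] [CompactSpace W] (ZW : Type) [TopologicalSpace ZW] [ChartedSpace (EuclideanSpace ℝ (Fin 3)) ZW] [IsManifold (𝓡 3) ∞ ZW] (ιW : ZW → W) (_ : Manifold.IsSmoothEmbedding (𝓡 3) (𝓡∂ 4)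 ∞ ιW) (_ : Set.range ιW = (𝓡∂ 4).boundary W) (φ : ZC ≃ₘ⟮𝓡 3, 𝓡 3⟯ ZW) (τ : ZC ≃ₘ⟮𝓡 3, 𝓡 3⟯ ZC), (∃ (kC : C → (Metric.sphere (0 : EuclideanSpace ℝ (Fin 5)) 1)) (kW : W → (Metric.sphere (0 : EuclideanSpace ℝ (Fin 5)) 1)), Manifold.IsSmoothEmbedding (𝓡∂ 4) (𝓡 4) ∞ kC ∧ Manifold.IsSmoothEmbedding (𝓡∂ 4) (𝓡 4) ∞ kW ∧ Set.range kC ∪ Set.range kW = Set.univ ∧ ∀ a b, kC a = kW b ↔ ∃ z, a = ιC z ∧ b = ιW (φ z)) → ∀ (P : Type) [TopologicalSpace P] [T2Space P] [SecondCountableTopology P] [ChartedSpace (EuclideanSpace ℝ (Fin 4)) P] [IsManifold (𝓡 4) ∞ P] [CompactSpace P] [MeasurableSpace P] [BorelSpace P] (jC : C → P) (jW : W → P), Manifold.IsSmoothEmbedding (𝓡∂ 4) (𝓡 4) ∞ jC → Manifold.IsSmoothEmbedding (𝓡∂ 4) (𝓡 4) ∞ jW → Set.range jC ∪ Set.range jW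 = Set.univ → (∀ a b, jC a = jW b ↔ ∃ z, a = ιC z ∧ b = ιW ((τ.trans φ) z)) → ∃ G : Literature.Geometry.Lorentzian.PseudoRiemannianMetric (𝓡 4) ∞ (EuclideanSpace ℝ (Fin 4)) (TangentSpace (𝓡 4) : P → Type _), ∃ hG : G.IsRiemannian, ∃ _ : G.HasLeviCivita, (∃ c : ℝ, 0 < c ∧ ∃ μ : P → ℝ, Continuous μ ∧ (∀ (x : P) (e : Fin 4 → TangentSpace (𝓡 4) x), G.IsOrthonormalFrame x e → μ x ≤ G.isotropicCurvature G.leviCivita x e) ∧ ∀ u : P → ℝ, ContMDiff (𝓡 4) 𝓘(ℝ, ℝ) 1 u → c * ∫ x in Set.range jC, u x ^ 2 ∂(Literature.Geometry.Lorentzian.riemannianMeasure (G.toContMDiffRiemannianMetric hG)) ≤ ∫ x in Set.range jC, (6 * G.gradSq u x + 3 * μ x * u x ^ 2) ∂(Literature.Geometry.Lorentzian.riemannianMeasure (G.toContMDiffRiemannianMetric hG))) ∧ (∃ c : ℝ, 0 < c ∧ ∃ μ : P → ℝ, Continuous μ ∧ (∀ (x : P) (e : Fin 4 → TangentSpace (𝓡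 4) x), G.IsOrthonormalFrame x e → μ x ≤ G.isotropicCurvature G.leviCivita x e) ∧ ∀ u : P → ℝ, ContMDiff (𝓡 4) 𝓘(ℝ, ℝ) 1 u → c * ∫ x in Set.range jW, u x ^ 2 ∂(Literature.Geometry.Lorentzian.riemannianMeasure (G.toContMDiffRiemannianMetric hG)) ≤ ∫ x in Set.range jW, (6 * G.gradSq u x + 3 * μ x * u x ^ 2) ∂(Literature.Geometry.Lorentzian.riemannianMeasure (G.toContMDiffRiemannianMetric hG)))

-- earlier CorkSideIsotropicFillIn (stmt-SmoothPoincare4-9826, replaced 2026-08-15T16:53:31Z -> stmt-SmoothPoincare4-11211): retired by None — ∀ (C : Type) [TopologicalSpace C] [T2Space C] [SecondCountableTopology C] [ChartedSpace (EuclideanHalfSpace 4) C] [IsManifold (𝓡∂ 4) ∞ C] [CompactSpace C] [ContractibleSpace C] (bC : Literature.Topology.FourManifolds.BoundaryData (𝓡∂ 4) C (𝓡 3)) (W : Type) [To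
/-- item stmt-SmoothPoincare4-11211 · crux · rank 4 · open · by planner
why it might fail: Strictly stronger than SPC4: freezing the exterior round may be impossible even when P ≅ S⁴ (metric rigidity of exotically re-embedded cork exteriors); and the twisted collar forces a region of negative isotropic curvature whose Neumann cost on a thin cork may exceed the interior margin 12·vol.
sources: ChenZhu2014, AkbulutMatveyev1998, Akbulut1991Fake, AkbulutRuberman2016, BarHanke2021, Literature.Barriers.SmoothPoincare4.RelativeContractibleBarrierFour
[crux] THE CORK ABSORBS THE TWIST AGAINST THE ROUND EXTERIOR (one-sided, recommended first attack
and calibration): with the data of CorkIsotropicBracketing (boundary 3-manifolds Z_C, Z_W and their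
embeddings explicit, as there) and the S⁴-side embeddings kC, kW explicit, P carries a Riemannian G
which on the exterior piece is ROUND — G = f*⟨·,·⟩_ℝ⁵ on T_pP for p ∈ jW(W), for a smooth f : P → S⁴
with f ∘ jW = kW — and is Neumann-isotropic-positive on the cork piece jC(C). Equivalently: the
compact contractible C admits a metric whose boundary germ is the τ-TWISTED round germ of ∂C ⊂ S⁴
and whose Neumann ground state of −6Δ + 3m is positive. NOT implied by SPC4 (even for cork twists
known to be standard the round exterior sits exotically re-embedded, cf. card cork-twins-census), so
it is a genuine test of the mechanism on e.g. the Akbulut–Mazur cork, where P ≅ S⁴ is known; true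
when τ extends over C (pull back). [deps: CorkIsotropicBracketing] [difficulty: open-problem] -/
@[route_item "route-SmoothPoincare4-IsotropicCorkBracketing", crux]
def CorkSideIsotropicFillIn : Prop :=
  ∀ (C : Type) [TopologicalSpace C] [T2Space C] [SecondCountableTopology C] [ChartedSpace (EuclideanHalfSpace 4) C] [IsManifold (𝓡∂ 4) ∞ C] [CompactSpace C] [ContractibleSpace C] (ZC : Type) [TopologicalSpace ZC] [ChartedSpace (EuclideanSpace ℝ (Fin 3)) ZC] [IsManifold (𝓡 3) ∞ ZC] (ιC : ZC → C) (_ : Manifold.IsSmoothEmbedding (𝓡 3) (𝓡∂ 4) ∞ ιC) (_ : Set.range ιC = (𝓡∂ 4).boundary C) (W : Type) [TopologicalSpace W] [T2Space W] [SecondCountableTopology W] [ChartedSpace (EuclideanHalfSpace 4) W] [IsManifold (𝓡∂ 4) ∞ W] [CompactSpace W] (ZW : Type) [TopologicalSpace ZW] [ChartedSpace (EuclideanSpace ℝ (Fin 3)) ZW] [IsManifold (𝓡 3) ∞ ZW] (ιW : ZW → W) (_ : Manifold.IsSmoothEmbedding (𝓡 3) (𝓡∂ 4) ∞ ιW) (_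 : Set.range ιW = (𝓡∂ 4).boundary W) (φ : ZC ≃ₘ⟮𝓡 3, 𝓡 3⟯ ZW) (τ : ZC ≃ₘ⟮𝓡 3, 𝓡 3⟯ ZC) (kC : C → Metric.sphere (0 : EuclideanSpace ℝ (Fin 5)) 1) (kW : W → Metric.sphere (0 : EuclideanSpace ℝ (Fin 5)) 1), Manifold.IsSmoothEmbedding (𝓡∂ 4) (𝓡 4) ∞ kC → Manifold.IsSmoothEmbedding (𝓡∂ 4) (𝓡 4) ∞ kW → Set.range kC ∪ Set.range kW = Set.univ → (∀ a b, kC a = kW b ↔ ∃ z, a = ιC z ∧ b = ιW (φ z)) → ∀ (P : Type) [TopologicalSpace P] [T2Space P] [SecondCountableTopology P] [ChartedSpace (EuclideanSpace ℝ (Fin 4)) P] [IsManifold (𝓡 4) ∞ P] [CompactSpace P] [MeasurableSpace P] [BorelSpace P] (jC : C → P) (jW : W → P), Manifold.IsSmoothEmbedding (𝓡∂ 4) (𝓡 4) ∞ jC → Manifold.IsSmoothEmbedding (𝓡∂ 4) (𝓡 4) ∞ jW → Set.range jC ∪ Set.range jW = Set.univ → (∀ a b, jC a = jW b ↔ ∃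 z, a = ιC z ∧ b = ιW ((τ.trans φ) z)) → ∃ G : Literature.Geometry.Lorentzian.PseudoRiemannianMetric (𝓡 4) ∞ (EuclideanSpace ℝ (Fin 4)) (TangentSpace (𝓡 4) : P → Type _), ∃ hG : G.IsRiemannian, ∃ _ : G.HasLeviCivita, (∃ f : P → Metric.sphere (0 : EuclideanSpace ℝ (Fin 5)) 1, ContMDiff (𝓡 4) (𝓡 4) ∞ f ∧ (∀ w, f (jW w) = kW w) ∧ ∀ (w : W) (v v' : TangentSpace (𝓡 4) (jW w)), G.val (jW w) v v' = inner ℝ (show EuclideanSpace ℝ (Fin 5) from mfderiv (𝓡 4) 𝓘(ℝ, EuclideanSpace ℝ (Fin 5)) (Subtype.val ∘ f) (jW w) v) (show EuclideanSpace ℝ (Fin 5) from mfderiv (𝓡 4) 𝓘(ℝ, EuclideanSpace ℝ (Fin 5)) (Subtype.val ∘ f) (jW w) v')) ∧ (∃ c : ℝ, 0 < c ∧ ∃ μ : P → ℝ, Continuous μ ∧ (∀ (x : P) (e : Fin 4 → TangentSpace (𝓡 4) x), G.IsOrthonormalFrame x e → μ x ≤ G.isotropicCurvature G.leviCivita x e)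 ∧ ∀ u : P → ℝ, ContMDiff (𝓡 4) 𝓘(ℝ, ℝ) 1 u → c * ∫ x in Set.range jC, u x ^ 2 ∂(Literature.Geometry.Lorentzian.riemannianMeasure (G.toContMDiffRiemannianMetric hG)) ≤ ∫ x in Set.range jC, (6 * G.gradSq u x + 3 * μ x * u x ^ 2) ∂(Literature.Geometry.Lorentzian.riemannianMeasure (G.toContMDiffRiemannianMetric hG)))

-- earlier SeamNull (stmt-SmoothPoincare4-9829, replaced 2026-08-15T16:53:31Z -> stmt-SmoothPoincare4-11212): retired by None — ∀ (C : Type) [TopologicalSpace C] [T2Space C] [SecondCountableTopology C] [ChartedSpace (EuclideanHalfSpace 4) C] [IsManifold (𝓡∂ 4) ∞ C] [CompactSpace C] (bC : Literature.Topology.FourManifolds.BoundaryData (𝓡∂ 4) C (𝓡 3)) (W : Type) [TopologicalSpace W] [T2Space W] [Second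
/-- item stmt-SmoothPoincare4-11212 · support · rank 9 · closed · proved by Summit.SmoothPoincare4.SmoothPoincare4.Theorems.seamNull_proof @ d76edc7e4e3d (prover) · by planner
sources: Federer1969, Chavel2006, Hirsch1976
[support] the seam of a boundary gluing is a null set: for compact pieces C, W (boundaries given as
smooth 3-manifolds Z_C, Z_W embedded by ι_C, ι_W onto (𝓡∂ 4).boundary C resp. W) embedded in a
closed 4-manifold P as a gluing along ψ : Z_C ≃ Z_W (explicit piece embeddings jC, jW covering P, jC
a = jW b ↔ ∃ z, a = ι_C z ∧ b = ι_W (ψ z)), the common image jC(C) ∩ jW(W) = jC(∂C) — a compact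
smooth hypersurface — has Riemannian measure zero for every Riemannian metric on P (chart formula
for dV + Lebesgue-nullity of C¹ images of 3-manifolds). [difficulty: L] -/
@[route_item "route-SmoothPoincare4-IsotropicCorkBracketing", crux]
def SeamNull : Prop :=
  ∀ (C : Type) [TopologicalSpace C] [T2Space C] [SecondCountableTopology C] [ChartedSpace (EuclideanHalfSpace 4) C] [IsManifold (𝓡∂ 4) ∞ C] [CompactSpace C] (ZC : Type) [TopologicalSpace ZC] [ChartedSpace (EuclideanSpace ℝ (Fin 3)) ZC] [IsManifold (𝓡 3) ∞ ZC] (ιC : ZC → C) (_ : Manifold.IsSmoothEmbedding (𝓡 3) (𝓡∂ 4) ∞ ιC) (_ : Set.range ιC = (𝓡∂ 4).boundary C) (W : Type) [TopologicalSpace W] [T2Space W] [SecondCountableTopology W] [ChartedSpace (EuclideanHalfSpace 4) W] [IsManifold (𝓡∂ 4) ∞ W] [CompactSpace W] (ZW : Type) [TopologicalSpace ZW] [ChartedSpace (EuclideanSpace ℝ (Fin 3)) ZW] [IsManifold (𝓡 3) ∞ ZW] (ιW : ZW → W) (_ : Manifold.IsSmoothEmbedding (𝓡 3) (𝓡∂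 4) ∞ ιW) (_ : Set.range ιW = (𝓡∂ 4).boundary W) (ψ : ZC ≃ₘ⟮𝓡 3, 𝓡 3⟯ ZW), ∀ (P : Type) [TopologicalSpace P] [T2Space P] [SecondCountableTopology P] [ChartedSpace (EuclideanSpace ℝ (Fin 4)) P] [IsManifold (𝓡 4) ∞ P] [CompactSpace P] [MeasurableSpace P] [BorelSpace P] (jC : C → P) (jW : W → P), Manifold.IsSmoothEmbedding (𝓡∂ 4) (𝓡 4) ∞ jC → Manifold.IsSmoothEmbedding (𝓡∂ 4) (𝓡 4) ∞ jW → Set.range jC ∪ Set.range jW = Set.univ → (∀ a b, jC a = jW b ↔ ∃ z, a = ιC z ∧ b = ιW (ψ z)) → ∀ (G : Literature.Geometry.Lorentzian.PseudoRiemannianMetric (𝓡 4) ∞ (EuclideanSpace ℝ (Fin 4)) (TangentSpace (𝓡 4) : P → Type _)) (hG : G.IsRiemannian), (Literature.Geometry.Lorentzian.riemannianMeasure (G.toContMDiffRiemannianMetric hG)) (Set.range jC ∩ Set.range jW) = 0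

-- earlier CorkPresentation (stmt-SmoothPoincare4-9830, replaced 2026-08-15T16:53:31Z -> stmt-SmoothPoincare4-11213): retired by None — ∀ (M : Type) [TopologicalSpace M] [T2Space M] [SecondCountableTopology M] [ChartedSpace (EuclideanSpace ℝ (Fin 4)) M] [IsManifold (𝓡 4) ∞ M], M ≃ₕ Metric.sphere (0 : EuclideanSpace ℝ (Fin 5)) 1 → ∃ (C : Type) (_ : TopologicalSpace C) (_ : T2Space C) (_ : SecondCounta
/-- item stmt-SmoothPoincare4-11213 · support · rank 9 · open · by planner
sources: Matveyev1996, CurtisFreedmanHsiangStong1996, KervaireMilnorAnnals1963, Literature.Topology.FourManifolds.isHCobordant_sphere_of_homotopySphere_four, Literature.Topology.FourManifolds.Matveyev1996_decomposition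
[support] NAMED-FACT ITEM (Θ₄ = 0 + the cork theorem in Matveyev's two-piece form; PROVED in the
tree from those two facts as
`Literature.Topology.FourManifolds.HomotopySphere.exists_corkPresentation_of_facts`, here in the
summit's binder form with the boundary data UNBUNDLED — cone repair 2026-08-15: the boundary
3-manifolds Z_C, Z_W with their embeddings onto (𝓡∂ 4).boundary are the fields of the tree's
`BoundaryData`, and both gluings are spelled out as explicit piece embeddings, the definiens of
`IsBoundaryGluing`; a prover rebundles ⟨Z, ι, h, h'⟩ as a `BoundaryData` and destructures
`IsBoundaryGluing` by `obtain` in the Theorems file): every smooth closed M ≃ₕ S⁴ is C ∪_(φ∘τ) W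
where S⁴ = C ∪_φ W, C compact contractible, W compact, both smooth 4-manifolds with boundary, τ ∈
Diff(Z_C). Packaging M ≃ₕ S⁴ as a HomotopySphere uses the proved compactness/orientability
discharges. [difficulty: open-problem] -/
@[route_item "route-SmoothPoincare4-IsotropicCorkBracketing", crux]
def CorkPresentation : Prop :=
  ∀ (M : Type) [TopologicalSpace M] [T2Space M] [SecondCountableTopology M] [ChartedSpace (EuclideanSpace ℝ (Fin 4)) M] [IsManifold (𝓡 4) ∞ M], M ≃ₕ Metric.sphere (0 : EuclideanSpace ℝ (Fin 5)) 1 → ∃ (C : Type) (_ : TopologicalSpace C) (_ : T2Space C) (_ : SecondCountableTopology C) (_ : ChartedSpace (EuclideanHalfSpace 4) C) (_ : IsManifold (𝓡∂ 4) ∞ C) (_ : CompactSpace C) (_ : ContractibleSpace C) (ZC : Type) (_ : TopologicalSpace ZC) (_ : ChartedSpace (EuclideanSpace ℝ (Fin 3)) ZC) (_ : IsManifold (𝓡 3) ∞ ZC) (ιC : ZC → C) (_ : Manifold.IsSmoothEmbedding (𝓡 3) (𝓡∂ 4) ∞ ιC) (_ : Set.range ιC = (𝓡∂ 4).boundary C)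 (W : Type) (_ : TopologicalSpace W) (_ : T2Space W) (_ : SecondCountableTopology W) (_ : ChartedSpace (EuclideanHalfSpace 4) W) (_ : IsManifold (𝓡∂ 4) ∞ W) (_ : CompactSpace W) (ZW : Type) (_ : TopologicalSpace ZW) (_ : ChartedSpace (EuclideanSpace ℝ (Fin 3)) ZW) (_ : IsManifold (𝓡 3) ∞ ZW) (ιW : ZW → W) (_ : Manifold.IsSmoothEmbedding (𝓡 3) (𝓡∂ 4) ∞ ιW) (_ : Set.range ιW = (𝓡∂ 4).boundary W) (φ : ZC ≃ₘ⟮𝓡 3, 𝓡 3⟯ ZW) (τ : ZC ≃ₘ⟮𝓡 3, 𝓡 3⟯ ZC), (∃ (kC : C → (Metric.sphere (0 : EuclideanSpace ℝ (Fin 5)) 1)) (kW : W → (Metric.sphere (0 : EuclideanSpace ℝ (Fin 5)) 1)), Manifold.IsSmoothEmbedding (𝓡∂ 4) (𝓡 4) ∞ kC ∧ Manifold.IsSmoothEmbedding (𝓡∂ 4) (𝓡 4) ∞ kW ∧ Set.range kC ∪ Set.range kW = Set.univ ∧ ∀ a b, kC a = kW b ↔ ∃ z, a = ιC z ∧ b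 = ιW (φ z)) ∧ (∃ (jC : C → M) (jW : W → M), Manifold.IsSmoothEmbedding (𝓡∂ 4) (𝓡 4) ∞ jC ∧ Manifold.IsSmoothEmbedding (𝓡∂ 4) (𝓡 4) ∞ jW ∧ Set.range jC ∪ Set.range jW = Set.univ ∧ ∀ a b, jC a = jW b ↔ ∃ z, a = ιC z ∧ b = ιW ((τ.trans φ) z))

/-- item stmt-SmoothPoincare4-9827 · support · rank 9 · closed · proved by Summit.SmoothPoincare4.SmoothPoincare4.Theorems.conformalPic_proof (prover) · by planner
sources: ChenZhu2014, GurskyLebrun1999, Gursky2000, MicallefWang1993, Hamilton1997, Literature.Geometry.Riemannian.hamilton_positiveIsotropicCurvature_iff_blocks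
[support] Chen–Zhu's first step (KNOWN; ChenZhu2014 Cor. 2.2 = GurskyLebrun1999 Prop. 3, and §3
first paragraph): on a closed smooth 4-manifold, a Riemannian metric with positive definite
isotropic Yamabe form is conformal to — in particular there exists — a metric of positive isotropic
curvature (first eigenfunction u > 0 of −6Δ + 3μ_ε for a smoothing μ_ε ≤ μ; σ_(u²g) = u⁻³(−6Δu + σ_g
u) > 0; σ > 0 ⇔ PIC by the Hamilton/Micallef–Wang block criterion). [difficulty: XL] -/
@[route_item "route-SmoothPoincare4-IsotropicCorkBracketing", crux]
def ConformalPic : Prop :=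
  ∀ (M : Type) [TopologicalSpace M] [T2Space M] [SecondCountableTopology M] [ChartedSpace (EuclideanSpace ℝ (Fin 4)) M] [IsManifold (𝓡 4) ∞ M] [CompactSpace M] [MeasurableSpace M] [BorelSpace M] (G : Literature.Geometry.Lorentzian.PseudoRiemannianMetric (𝓡 4) ∞ (EuclideanSpace ℝ (Fin 4)) (TangentSpace (𝓡 4) : M → Type _)) (hG : G.IsRiemannian) [G.HasLeviCivita], (∃ c : ℝ, 0 < c ∧ ∃ μ : M → ℝ, Continuous μ ∧ (∀ (x : M) (e : Fin 4 → TangentSpace (𝓡 4) x), G.IsOrthonormalFrame x e → μ x ≤ G.isotropicCurvature G.leviCivita x e) ∧ ∀ u : M → ℝ, ContMDiff (𝓡 4) 𝓘(ℝ, ℝ) 1 u → c * ∫ x, u x ^ 2 ∂(Literature.Geometry.Lorentzian.riemannianMeasure (G.toContMDiffRiemannianMetric hG)) ≤ ∫ x, (6 * G.gradSq u x + 3 * μ x * u x ^ 2) ∂(Literature.Geometry.Lorentzian.riemannianMeasure (G.toContMDiffRiemannianMetric hG))) → ∃ G' : Literature.Geometry.Lorentzian.PseudoRiemannianMetric (𝓡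 4) ∞ (EuclideanSpace ℝ (Fin 4)) (TangentSpace (𝓡 4) : M → Type _), G'.IsRiemannian ∧ G'.HasPositiveIsotropicCurvature

/-- item stmt-SmoothPoincare4-9828 · support · rank 9 · closed · proved by Summit.SmoothPoincare4.SmoothPoincare4.Theorems.neumannBracketing_proof (prover) · by planner
sources: panama:375646429642774, Chavel2006, Federer1969
[support] DIRICHLET–NEUMANN BRACKETING, the half that is pure measure theory: if closed sets S₁, S₂
cover P with dV_G(S₁ ∩ S₂) = 0 and the isotropic form of G is Neumann-positive on each (constants
c₁, c₂; lower bounds μ₁, μ₂ ≤ isotropic curvatures), then it is positive on P with c = min(c₁,c₂)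
and μ = max(μ₁,μ₂) (∫_P = ∫_S₁ + ∫_S₂; integrability of 6|∇u|² + 3μu² for u ∈ C¹ on compact P).
[difficulty: M] -/
@[route_item "route-SmoothPoincare4-IsotropicCorkBracketing", crux]
def NeumannBracketing : Prop :=
  ∀ (P : Type) [TopologicalSpace P] [T2Space P] [SecondCountableTopology P] [ChartedSpace (EuclideanSpace ℝ (Fin 4)) P] [IsManifold (𝓡 4) ∞ P] [CompactSpace P] [MeasurableSpace P] [BorelSpace P] (G : Literature.Geometry.Lorentzian.PseudoRiemannianMetric (𝓡 4) ∞ (EuclideanSpace ℝ (Fin 4)) (TangentSpace (𝓡 4) : P → Type _)) (hG : G.IsRiemannian) [G.HasLeviCivita] (S₁ S₂ : Set P), IsClosed S₁ → IsClosed S₂ → S₁ ∪ S₂ = Set.univ → (Literature.Geometry.Lorentzian.riemannianMeasure (G.toContMDiffRiemannianMetric hG)) (S₁ ∩ S₂) = 0 → (∃ c : ℝ, 0 < c ∧ ∃ μ : P → ℝ, Continuous μ ∧ (∀ (x : P) (e : Fin 4 → TangentSpace (𝓡 4) x), G.IsOrthonormalFrame x e → μ x ≤ G.isotropicCurvature G.leviCivita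 x e) ∧ ∀ u : P → ℝ, ContMDiff (𝓡 4) 𝓘(ℝ, ℝ) 1 u → c * ∫ x in S₁, u x ^ 2 ∂(Literature.Geometry.Lorentzian.riemannianMeasure (G.toContMDiffRiemannianMetric hG)) ≤ ∫ x in S₁, (6 * G.gradSq u x + 3 * μ x * u x ^ 2) ∂(Literature.Geometry.Lorentzian.riemannianMeasure (G.toContMDiffRiemannianMetric hG))) → (∃ c : ℝ, 0 < c ∧ ∃ μ : P → ℝ, Continuous μ ∧ (∀ (x : P) (e : Fin 4 → TangentSpace (𝓡 4) x), G.IsOrthonormalFrame x e → μ x ≤ G.isotropicCurvature G.leviCivita x e) ∧ ∀ u : P → ℝ, ContMDiff (𝓡 4) 𝓘(ℝ, ℝ) 1 u → c * ∫ x in S₂, u x ^ 2 ∂(Literature.Geometry.Lorentzian.riemannianMeasure (G.toContMDiffRiemannianMetric hG)) ≤ ∫ x in S₂, (6 * G.gradSq u x + 3 * μ x * u x ^ 2) ∂(Literature.Geometry.Lorentzian.riemannianMeasure (G.toContMDiffRiemannianMetric hG))) → (∃ c : ℝ, 0 < c ∧ ∃ μ : P → ℝ, Continuous μ ∧ (∀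 (x : P) (e : Fin 4 → TangentSpace (𝓡 4) x), G.IsOrthonormalFrame x e → μ x ≤ G.isotropicCurvature G.leviCivita x e) ∧ ∀ u : P → ℝ, ContMDiff (𝓡 4) 𝓘(ℝ, ℝ) 1 u → c * ∫ x, u x ^ 2 ∂(Literature.Geometry.Lorentzian.riemannianMeasure (G.toContMDiffRiemannianMetric hG)) ≤ ∫ x, (6 * G.gradSq u x + 3 * μ x * u x ^ 2) ∂(Literature.Geometry.Lorentzian.riemannianMeasure (G.toContMDiffRiemannianMetric hG)))

/-- item stmt-SmoothPoincare4-9831 · support · rank 9 · closed · proved by Summit.SmoothPoincare4.SmoothPoincare4.Theorems.roundPullback_proof (prover) · by planner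
sources: ONeill1983, MicallefMoore1988, Literature.Geometry.Riemannian.roundMetric
[support] NO SLACK LOST / KILL-DIRECTION ENGINE: a closed 4-manifold diffeomorphic to S⁴ carries a
Riemannian metric (the pulled-back round one, isotropic curvature ≡ 4) whose isotropic form is
Neumann-positive on EVERY measurable subset, with μ ≡ 4 and c = 12. Hence a cork twist P for which
CorkIsotropicBracketing fails is exotic (¬SPC4), and SPC4 ⇒ CorkIsotropicBracketing. [difficulty: L] -/
@[route_item "route-SmoothPoincare4-IsotropicCorkBracketing", crux]
def RoundPullback : Prop :=
  ∀ (P : Type) [TopologicalSpace P] [T2Space P] [SecondCountableTopology P] [ChartedSpace (EuclideanSpace ℝ (Fin 4)) P] [IsManifold (𝓡 4) ∞ P] [CompactSpace P] [MeasurableSpace P] [BorelSpace P], Nonempty (P ≃ₘ⟮𝓡 4, 𝓡 4⟯ Metric.sphere (0 : EuclideanSpace ℝ (Fin 5)) 1) → ∃ G : Literature.Geometry.Lorentzian.PseudoRiemannianMetric (𝓡 4) ∞ (EuclideanSpace ℝ (Fin 4)) (TangentSpace (𝓡 4) : P → Type _), ∃ hG : G.IsRiemannian, ∃ _ : G.HasLeviCivita,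 ∀ S : Set P, MeasurableSet S → (∃ c : ℝ, 0 < c ∧ ∃ μ : P → ℝ, Continuous μ ∧ (∀ (x : P) (e : Fin 4 → TangentSpace (𝓡 4) x), G.IsOrthonormalFrame x e → μ x ≤ G.isotropicCurvature G.leviCivita x e) ∧ ∀ u : P → ℝ, ContMDiff (𝓡 4) 𝓘(ℝ, ℝ) 1 u → c * ∫ x in S, u x ^ 2 ∂(Literature.Geometry.Lorentzian.riemannianMeasure (G.toContMDiffRiemannianMetric hG)) ≤ ∫ x in S, (6 * G.gradSq u x + 3 * μ x * u x ^ 2) ∂(Literature.Geometry.Lorentzian.riemannianMeasure (G.toContMDiffRiemannianMetric hG)))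

/-- item stmt-SmoothPoincare4-9832 · support · rank 9 · closed · proved by Summit.SmoothPoincare4.SmoothPoincare4.Theorems.corkReduction_proof (prover) · by planner
sources: BrockerJanich1982, Hirsch1976
[support] LAYER-2 GLUE (pure logic + unfolding IsBoundaryGluing into its embeddings; ranges of the
compact pieces are closed): CorkPresentation → SeamNull → NeumannBracketing →
CorkIsotropicBracketing → IsotropicFormPositive. [difficulty: provable-now] -/
@[route_item "route-SmoothPoincare4-IsotropicCorkBracketing", crux]
def CorkReduction : Prop :=
  CorkPresentation → SeamNull → NeumannBracketing → CorkIsotropicBracketing → IsotropicFormPositive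

/-- item stmt-SmoothPoincare4-9833 · support · rank 9 · closed · proved by Summit.SmoothPoincare4.SmoothPoincare4.Theorems.roundSideGivesBracketing_proof (prover) · by planner
sources: ONeill1983, MicallefMoore1988, Literature.Geometry.Lorentzian.PseudoRiemannianMetric.comap
[support] GLUE for the one-sided crux: a metric that is round on the exterior piece (local isometry
f into S⁴ ⊂ ℝ⁵) has isotropic curvature ≡ 4 there (naturality of curvature under local isometries,
continuity of the minimal isotropic curvature up to the seam), so the exterior piece is
Neumann-positive with μ = minimal isotropic curvature of G and c = 12; hence CorkSideIsotropicFillIn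
→ CorkIsotropicBracketing. [difficulty: L] -/
@[route_item "route-SmoothPoincare4-IsotropicCorkBracketing", crux]
def RoundSideGivesBracketing : Prop :=
  CorkSideIsotropicFillIn → CorkIsotropicBracketing

/-- item stmt-SmoothPoincare4-9834 · assembly · rank 1 · closed · proved by Summit.SmoothPoincare4.SmoothPoincare4.Theorems.isotropicCorkBracketing_assembly_proof (prover) · by planner
sources: ChenZhu2014, Hamilton1997, ChenTangZhu2012, HatcherAT2002
[assembly] IsotropicFormPositive → ConformalPic → HamiltonChenTangZhu → SmoothPoincare4 (the
deciding theorem `closes`, proved). -/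
@[route_item "route-SmoothPoincare4-IsotropicCorkBracketing", crux]
def Assembly : Prop :=
  IsotropicFormPositive → ConformalPic → HamiltonChenTangZhu → _root_.SmoothPoincare4

/-! D-0027 §2.1 — DECIDING THEOREM (planner-authored via `route open/edit --closes-file`; by planner-rrepair-SmoothPoincare4-IsotropicCorkB-b3a947e6-g2-0 2026-08-15T16:53:31Z):
its hypotheses are this route's items and its conclusion the sub-problem Statement (glue_lint), and it elaborates with this file. -/

@[closes "route-SmoothPoincare4-IsotropicCorkBracketing"] theorem closes (hT : IsotropicFormPositive) (hH : HamiltonChenTangZhu) (_hK : CorkIsotropicBracketing)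
    (_hS : CorkSideIsotropicFillIn) (hC : ConformalPic) (_hB : NeumannBracketing) (_hN : SeamNull)
    (_hP : CorkPresentation) (_hR : RoundPullback) (_hRed : CorkReduction)
    (_hRS : RoundSideGivesBracketing) (_hA : Assembly) :
    _root_.SmoothPoincare4 := by
  unfold _root_.SmoothPoincare4 Literature.SPC4.SmoothPoincareConjectureFour
    ContinuousMap.HomotopyEquiv.NonemptyDiffeomorphSphere
  intro M _ _ _ _ _ e
  haveI : CompactSpace M :=
    Literature.Topology.FourManifolds.compactSpace_of_homotopyEquiv_sphere_four_holds M e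
  haveI : SimplyConnectedSpace (Metric.sphere (0 : EuclideanSpace ℝ (Fin 5)) 1) :=
    Literature.Topology.FourManifolds.simplyConnectedSpace_sphere_four_holds
  haveI : SimplyConnectedSpace M := e.simplyConnectedSpace
  letI : MeasurableSpace M := borel M
  haveI : BorelSpace M := ⟨rfl⟩
  obtain ⟨G, hG, hLC, hpos⟩ := hT M e
  haveI := hLC
  obtain ⟨G', hG', hpic⟩ := hC M G hG hpos
  exact hH M ⟨G', hG', hpic⟩

end Summit.SmoothPoincare4.SmoothPoincare4.Theses.IsotropicCorkBracketing
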